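import Summits.QuantumFields.BalabanUV.Beta.VertexToriSymmetryCovariant

/-!
# Beta / VertexToriSymmetryJet — the JET FUNCTIONAL inherits `q`-slot covariance: reflection ∕ permutation transports for the engines'
# actual integrand `G = jetFunctional f` (β sub-cell, BINDER-OWNERS row CAP-k, lineage `b2b-balaban-beta-an5`, gen 22; node
# BETA-an5-g22-TORI-SYMMETRY part 4)

The engines' per-fibre integrand is the JET FUNCTIONAL `G q = ½·∂₁∂₂ f(q; 0, 0)` (`Beta/JetCoefficientCauchy.jetFunctional`) of the
three-slot one-loop form `f(q; p₁, p₂) = tr(A⁻¹B) − tr(A⁻¹ C A′⁻¹ D)` with the SHIFTED family `A′(q; p₁, p₂) = k₀(q − p₁v₁ − p₂v₂)`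
(`ConjReflectionAlgebra.MatConjSymm.shift₃`'s literal shape, REAL direction vectors `v₁, v₂`).  Under a symmetry `τ` of the `q`-slot that
FIXES THE JET DIRECTIONS (a coordinate reflection `reflectAt ν` with `(v₁)_ν = (v₂)_ν = 0` — CAP-KERNEL §4.15 (c)'s «q₂, q₃ sign flips» when the
jets run along directions 0, 1 —, or a permutation fixing `v₁, v₂`) every covariant family stays covariant AT EACH `(p₁, p₂)`, the scalar form is
`τ`-invariant at each `(p₁, p₂)`, and hence so is its jet functional — with NO sign flip (contrast `conjNeg`, where the two `p`-derivatives
flip sign twice, `ConjReflectionAlgebra` §5).  This module records exactly that: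

* §1 `MatCovariant₃ τ U V A := ∀ q p₁ p₂, A (τ q) p₁ p₂ = U * A q p₁ p₂ * V` (`q`-slot covariance of a three-slot family) ⟺ covariance at
  each `(p₁, p₂)`; `q`-only families (`MatCovariant.to₃`), `q`-INDEPENDENT families commuting with the conjugation (`matCovariant₃_of_p`: the
  `p`-phases and `I·p` generators times tables), THE SHIFTED FAMILY `MatCovariant.shift₃` under `τ (q − p₁v₁ − p₂v₂) = τ q − p₁v₁ − p₂v₂`
  (`reflectAt_shift` for `(v₁)_ν = (v₂)_ν = 0`, `permute_shift` for `vᵢ ∘ σ = vᵢ`); the three-slot one-loop form is `τ`-invariant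
  (`oneLoopForm₃_invariant`).
* §2 `jetFunctional_eq_of_invariant₃` (`f (τ q) · · = f q · ·` ⟹ `jetFunctional f (τ q) = jetFunctional f q`), the TRANSPORT of norm bounds
  of `jetFunctional f` along such `τ`, and the END `jet_norm_le_vertexTori_of_plusRegion` (a face bound of the jet functional on the vertex tori
  with `Im q_ν = +w_ν` for the covariantly reflected non-jet directions `ν ∈ V` is a bound on all vertex tori — `2^{|V|}` of the `2^{d+1}` sign
  classes identified; combine with `VertexToriSymmetryEnds.transport_norm_conjNeg` ∕ `ConjReflectionAlgebra.conjSymm_jetFunctional` for the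
  residual flip).

HONEST FRAMING.  Kernel glue ([folklore]): no symmetry of the cell's actual tables is asserted; no number of the β-function, no certificate, no
binder INSTANCE.  Discharging `BetaPertH` would make Bałaban's ultraviolet stability unconditional — NOT the continuum limit, NOT the Clay problem.
0 `sorry`, 0 cite tags.
-/

namespace Summit.QuantumFields.BalabanUV.Beta.VertexToriSymmetry

open Complex Set Matrix
open Literature.MathematicalPhysics.QuantumFieldTheory.Balaban1983to89
open Summit.QuantumFields.BalabanUV.Beta.TubeMaximumModulus
open Summit.QuantumFields.BalabanUV.Beta.JetCoefficientCauchy (jetFunctional)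
open scoped Real ComplexConjugate Matrix.Norms.L2Operator

noncomputable section

variable {d : ℕ} {n : Type*} [Fintype n] [DecidableEq n]

/-! ## §1 Three-slot covariance in the `q`-slot -/

section ThreeSlot

/-- `q`-SLOT COVARIANCE of a three-slot matrix family (the `p`-slots untouched). [folklore] -/
def MatCovariant₃ (τ : (Fin (d + 1) → ℂ) → (Fin (d + 1) → ℂ)) (U V : Matrix n n ℂ)
    (A : (Fin (d + 1) → ℂ) → ℂ → ℂ → Matrix n n ℂ) : Prop :=
  ∀ q p₁ p₂, A (τ q) p₁ p₂ = U * A q p₁ p₂ * V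

variable {τ : (Fin (d + 1) → ℂ) → (Fin (d + 1) → ℂ)} {U V : Matrix n n ℂ}

omit [DecidableEq n] in
/-- three-slot covariance is covariance at each `(p₁, p₂)`. [folklore] -/
theorem matCovariant₃_iff {A : (Fin (d + 1) → ℂ) → ℂ → ℂ → Matrix n n ℂ} :
    MatCovariant₃ τ U V A ↔ ∀ p₁ p₂, MatCovariant τ U V (fun q => A q p₁ p₂) :=
  ⟨fun h p₁ p₂ q => h q p₁ p₂, fun h q p₁ p₂ => h p₁ p₂ q⟩

omit [DecidableEq n] in
/-- a `q`-only covariant family as a three-slot family. [folklore] -/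
theorem MatCovariant.to₃ {A : (Fin (d + 1) → ℂ) → Matrix n n ℂ} (h : MatCovariant τ U V A) :
    MatCovariant₃ τ U V (fun q _ _ => A q) := fun q _ _ => h q

omit [DecidableEq n] in
/-- a `q`-INDEPENDENT family commuting with the conjugation at every `(p₁, p₂)` (the `p`-phases and `I·p` generators times tables). [folklore] -/
theorem matCovariant₃_of_p {K : ℂ → ℂ → Matrix n n ℂ} (hK : ∀ p₁ p₂, U * K p₁ p₂ * V = K p₁ p₂) :
    MatCovariant₃ τ U V (fun (_ : Fin (d + 1) → ℂ) p₁ p₂ => K p₁ p₂) := fun _ p₁ p₂ => (hK p₁ p₂).symm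

omit [DecidableEq n] in
/-- **THE SHIFTED FAMILY** `(q; p₁, p₂) ↦ A(q − p₁v₁ − p₂v₂)` (literal shape of `ConjReflectionAlgebra.MatConjSymm.shift₃`) is covariant whenever
`A` is and `τ` commutes with the shift. [folklore] -/
theorem MatCovariant.shift₃ {A : (Fin (d + 1) → ℂ) → Matrix n n ℂ} (h : MatCovariant τ U V A) (v₁ v₂ : Fin (d + 1) → ℝ)
    (hτ : ∀ (q : Fin (d + 1) → ℂ) (p₁ p₂ : ℂ),
      τ (fun i => q i - (v₁ i : ℂ) * p₁ - (v₂ i : ℂ) * p₂) = fun i => τ q i - (v₁ i : ℂ) * p₁ - (v₂ i : ℂ) * p₂) :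
    MatCovariant₃ τ U V (fun q p₁ p₂ => A (fun i => q i - (v₁ i : ℂ) * p₁ - (v₂ i : ℂ) * p₂)) := fun q p₁ p₂ => by
  show A (fun i => τ q i - (v₁ i : ℂ) * p₁ - (v₂ i : ℂ) * p₂) = _
  rw [← hτ q p₁ p₂, h]

/-- a coordinate reflection commutes with a shift along directions with vanishing `ν`-component. [folklore] -/
theorem reflectAt_shift (ν : Fin (d + 1)) {v₁ v₂ : Fin (d + 1) → ℝ} (h₁ : v₁ ν = 0) (h₂ : v₂ ν = 0)
    (q : Fin (d + 1) → ℂ) (p₁ p₂ : ℂ) :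
    reflectAt ν (fun i => q i - (v₁ i : ℂ) * p₁ - (v₂ i : ℂ) * p₂) = fun i => reflectAt ν q i - (v₁ i : ℂ) * p₁ - (v₂ i : ℂ) * p₂ := by
  funext μ
  by_cases h : μ = ν
  · subst h; simp [h₁, h₂]
  · simp [h]

/-- a coordinate permutation commutes with a shift along directions it fixes. [folklore] -/
theorem permute_shift (σ : Equiv.Perm (Fin (d + 1))) {v₁ v₂ : Fin (d + 1) → ℝ} (h₁ : ∀ μ, v₁ (σ μ) = v₁ μ) (h₂ : ∀ μ, v₂ (σ μ) = v₂ μ)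
    (q : Fin (d + 1) → ℂ) (p₁ p₂ : ℂ) :
    permute σ (fun i => q i - (v₁ i : ℂ) * p₁ - (v₂ i : ℂ) * p₂) = fun i => permute σ q i - (v₁ i : ℂ) * p₁ - (v₂ i : ℂ) * p₂ := by
  funext μ; simp [permute, h₁ μ, h₂ μ]

variable {A A' B C D : (Fin (d + 1) → ℂ) → ℂ → ℂ → Matrix n n ℂ}

/-- **THE THREE-SLOT ONE-LOOP FORM IS `τ`-INVARIANT IN THE `q`-SLOT** when all five families are covariant (`V U = 1`). [folklore] -/
theorem oneLoopForm₃_invariant (hVU : V * U = 1) (hA : MatCovariant₃ τ U V A) (hA' : MatCovariant₃ τ U V A')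
    (hB : MatCovariant₃ τ U V B) (hC : MatCovariant₃ τ U V C) (hD : MatCovariant₃ τ U V D) (q : Fin (d + 1) → ℂ) (p₁ p₂ : ℂ) :
    ((A (τ q) p₁ p₂)⁻¹ * B (τ q) p₁ p₂).trace - ((A (τ q) p₁ p₂)⁻¹ * C (τ q) p₁ p₂ * (A' (τ q) p₁ p₂)⁻¹ * D (τ q) p₁ p₂).trace
      = ((A q p₁ p₂)⁻¹ * B q p₁ p₂).trace - ((A q p₁ p₂)⁻¹ * C q p₁ p₂ * (A' q p₁ p₂)⁻¹ * D q p₁ p₂).trace :=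
  oneLoopForm_covariant (A := fun q => A q p₁ p₂) (A' := fun q => A' q p₁ p₂) (B := fun q => B q p₁ p₂)
    (C := fun q => C q p₁ p₂) (D := fun q => D q p₁ p₂) hVU
    (matCovariant₃_iff.mp hA p₁ p₂) (matCovariant₃_iff.mp hA' p₁ p₂) (matCovariant₃_iff.mp hB p₁ p₂)
    (matCovariant₃_iff.mp hC p₁ p₂) (matCovariant₃_iff.mp hD p₁ p₂) q

end ThreeSlot

/-! ## §2 The jet functional inherits the invariance (no sign flip) -/

section Jet

variable {f : (Fin (d + 1) → ℂ) → ℂ → ℂ → ℂ} {τ : (Fin (d + 1) → ℂ) → (Fin (d + 1) → ℂ)} {w : Fin (d + 1) → ℝ}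

omit [Fintype n] [DecidableEq n] in
/-- **`f (τ q; ·, ·) = f (q; ·, ·)` ⟹ `jetFunctional f (τ q) = jetFunctional f q`.** [folklore] -/
theorem jetFunctional_eq_of_invariant₃ (h : ∀ q p₁ p₂, f (τ q) p₁ p₂ = f q p₁ p₂) (q : Fin (d + 1) → ℂ) :
    jetFunctional f (τ q) = jetFunctional f q := by
  have e : f (τ q) = f q := funext fun p₁ => funext fun p₂ => h q p₁ p₂
  simp only [jetFunctional, e]

omit [Fintype n] [DecidableEq n] in
/-- TRANSPORT of a norm bound of the jet functional along coordinate reflections under which the jet integrand is invariant. [folklore] -/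
theorem transport_jet_norm_reflect {V : Finset (Fin (d + 1))} (h : ∀ ν ∈ V, ∀ q p₁ p₂, f (reflectAt ν q) p₁ p₂ = f q p₁ p₂) {M : ℝ} :
    ∀ ν ∈ V, ∀ q ∈ VertexTori w, ‖jetFunctional f q‖ ≤ M → ‖jetFunctional f (reflectAt ν q)‖ ≤ M :=
  transport_norm_reflect (G := jetFunctional f) fun ν hν q _ => jetFunctional_eq_of_invariant₃ (h ν hν) q

omit [Fintype n] [DecidableEq n] in
/-- **END**: a face bound of the jet functional on the vertex tori with `Im q_ν = +w_ν` for every covariantly reflected (non-jet) direction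
`ν ∈ V` is a bound on ALL vertex tori. [folklore] -/
theorem jet_norm_le_vertexTori_of_plusRegion (V : Finset (Fin (d + 1)))
    (h : ∀ ν ∈ V, ∀ q p₁ p₂, f (reflectAt ν q) p₁ p₂ = f q p₁ p₂) {M : ℝ}
    (hM : ∀ q ∈ VertexTori w, (∀ ν ∈ V, (q ν).im = w ν) → ‖jetFunctional f q‖ ≤ M) :
    ∀ q ∈ VertexTori w, ‖jetFunctional f q‖ ≤ M :=
  of_plusRegion (P := fun q => ‖jetFunctional f q‖ ≤ M) V (transport_jet_norm_reflect h) hM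

variable {U V : Matrix n n ℂ} {A A' B C D : (Fin (d + 1) → ℂ) → ℂ → ℂ → Matrix n n ℂ}

/-- **END FOR THE ENGINES' INTEGRAND**: with the five three-slot families covariant under the reflections of the directions `Vs` (per-direction
conjugators with `V U = 1`), a face bound of the JET FUNCTIONAL of the one-loop form on the vertex tori with `Im q_ν = +w_ν ∀ ν ∈ Vs` is a bound on
all vertex tori. [folklore] -/
theorem oneLoopJet_norm_le_vertexTori_of_plusRegion (Vs : Finset (Fin (d + 1))) (Uc Vc : Fin (d + 1) → Matrix n n ℂ)
    (hVU : ∀ ν ∈ Vs, Vc ν * Uc ν = 1)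
    (hA : ∀ ν ∈ Vs, MatCovariant₃ (reflectAt ν) (Uc ν) (Vc ν) A) (hA' : ∀ ν ∈ Vs, MatCovariant₃ (reflectAt ν) (Uc ν) (Vc ν) A')
    (hB : ∀ ν ∈ Vs, MatCovariant₃ (reflectAt ν) (Uc ν) (Vc ν) B) (hC : ∀ ν ∈ Vs, MatCovariant₃ (reflectAt ν) (Uc ν) (Vc ν) C)
    (hD : ∀ ν ∈ Vs, MatCovariant₃ (reflectAt ν) (Uc ν) (Vc ν) D) {M : ℝ}
    (hM : ∀ q ∈ VertexTori w, (∀ ν ∈ Vs, (q ν).im = w ν) →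
      ‖jetFunctional (fun q p₁ p₂ => ((A q p₁ p₂)⁻¹ * B q p₁ p₂).trace
        - ((A q p₁ p₂)⁻¹ * C q p₁ p₂ * (A' q p₁ p₂)⁻¹ * D q p₁ p₂).trace) q‖ ≤ M) :
    ∀ q ∈ VertexTori w, ‖jetFunctional (fun q p₁ p₂ => ((A q p₁ p₂)⁻¹ * B q p₁ p₂).trace
        - ((A q p₁ p₂)⁻¹ * C q p₁ p₂ * (A' q p₁ p₂)⁻¹ * D q p₁ p₂).trace) q‖ ≤ M :=
  jet_norm_le_vertexTori_of_plusRegion Vs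
    (fun ν hν q p₁ p₂ => oneLoopForm₃_invariant (hVU ν hν) (hA ν hν) (hA' ν hν) (hB ν hν) (hC ν hν) (hD ν hν) q p₁ p₂) hM

end Jet

end

end Summit.QuantumFields.BalabanUV.Beta.VertexToriSymmetry
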